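import Summits.QuantumFields.BalabanUV.T4Continuum.Support.VariationalCovariantPoincare
import Summits.QuantumFields.BalabanUV.T4Continuum.Support.VariationalCovariantFederbush
import Summits.QuantumFields.BalabanUV.T4Continuum.Support.ScalarBlockTrialFunction
import Summits.QuantumFields.BalabanUV.T4Continuum.Support.VariationalTransfer

/-!
# T⁴ programme, spine node NE2 (U1a), lane P2 — SUPPLIER LEAF UB⁺ OF THE VARIATIONAL ROUTE: a k-UNIFORM UPPER BOUND for the
# covariant scalar effective Laplacian (the block-spin value of the covariant Dirichlet form on the constraint fibre of the
# TRANSPORTED block averaging), by an EXPLICIT LOCAL competitor — every torus, every level, model level (U(1) charged scalar)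

NE2 formalisation swarm `b2b-balaban-t4-ne2-formalise-*`, leaf 04 GEN 2 (`prover-b2b-balaban-t4-ne2-formalise-leaf-04-g2-0`), acting as a
SUPPLIER SEAT for leaf UB⁺ of the P2 (variational) skeleton `t4/skeletons/NE2-t4-ne2-p2.md` v0.5 §2.C ∕ §7 («s3 UB⁺»); journal INTENT
CLAIMS.log l.7927.  Carriers = those of P2's leaves FED⁺ ∕ P⁺ (`VariationalCovariantFederbush` p210720, `VariationalCovariantPoincare`
p211276): the transported block average `QT n M T f z = n^{−d}Σ_j T(bpt z j)·f(bpt z j)` ([Balaban1985BackgroundPropagators] (3.19) p.393,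
SHAPE only, abelian) and the covariant Dirichlet sum `dirR n M R f = Σ_{μ,x}|R(x,μ)f(x+e_μ) − f(x)|²` ((3.3) pp.390–391, SHAPE only).

HONEST FRAMING (T4-DAG p. 1).  Rung (B)+1 only — NOT infinite volume, NOT a mass gap, NOT Clay.  Node NE2 is NOT IN PRINT and NOT
proved here.  MODEL LEVEL: the site transports `T : Tor (fine n M) → ℂ` (`|T x| = 1`) and bond phases `R` (`|R| ≤ 1`) are DATA; lattice
units; scalar (0-form) sector; U(1).  What is proved is OURS and elementary; nothing printed is a hypothesis; no `def`, no `def … : Prop`,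
no `sorry`; axioms standard.  HONEST DEPENDENCY (cell, verbatim): continuum YM on T⁴ ⇐ BetaPertH ∧ nine spine estimates (0/9 proved);
BetaPertH ⇐ (D1) ∧ (D4) ∧ CAP+tail; G-an2-4 gates asym, D1 and NE2/3/4.

THE STATEMENT (leaf UB⁺, skeleton §2.C «Δ′_k(Ū′)(μ) ≤ Λ_d(1 + c·n²a_c)·‖μ‖²»; here the local, model-level form).  Level `n = L^k`,
torus `Tor (fine n M)` over the unit torus `Tor M`, blocks `B(y) = {bpt n M y j}`.  HYPOTHESES: `|T x| = 1` (unitary site transports, so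
the constraint fibre is met exactly), `|R(x,μ)| ≤ 1`, and the IN-BLOCK one-bond transport defect

  `|R(x,μ)·conj(T(x+e_μ))·T(x) − 1| ≤ w`   for every bond `(x, x+e_μ)` with BOTH ends in the same block            (hw)

(for `T` = contour transports of `R` from the block base point this is the holonomy defect of ONE in-block loop «contour to x, bond,
contour back from x+e_μ», `≲ d·n·a` with `a` the plaquette defect, so `n·w ≍ d·n²a ≍ d·α` for a unit-scale-smooth background of field
strength `α`: k-UNIFORM; NO hypothesis relates transports of DIFFERENT blocks — no global frame, no global small field).  CONCLUSION:
for every unit-lattice field `φ` the EXPLICIT competitor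

  `λ_φ(x) := conj(T(x)) · (β₁^d)⁻¹ · ψ_φ(x)`,   `ψ_φ` = the in-block trial function of `ScalarBlockTrialFunction` (row B4.c, leaf-09:
  `ψ_φ(n·y+j) = φ(y)·Π_ν b(j_ν)`, `b(t) = (t+1)(n−t)/n²`, block means `β₁^d·φ`, `β₁ ≥ 1/6`, face values `≤ |φ|/n`)

satisfies the constraint EXACTLY, `QT n M T λ_φ = φ` (`QT_comp`), and

  `n²·Σ_{μ,x}|R(x,μ)λ_φ(x+e_μ) − λ_φ(x)|² ≤ 2d·(β₁^d)⁻²·((1 + n·w)² + 9)·n^d·Σ_y|φ(y)|²`      (`sq_mul_dirR_comp_le`),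

i.e. in physical units (`Sc(λ) = n^{2−d}Σ|D_Rλ|²`, `‖φ‖² = Σ_y|φ(y)|²` on the unit lattice) `Sc(λ_φ) ≤ 2d·36^d·((1 + n w)² + 9)·‖φ‖²`
(`physDir_comp_le`); hence the UB⁺ reading for P2's `VariationalTransfer.blockSpin`:

  `Δ′(φ) := blockSpin (QT n M T) Sc φ ≤ 2d·36^d·((1 + n w)² + 9)·‖φ‖²`                              (`blockSpin_covariant_le`)

and the `∃`-forms `exists_ub_phys` (LITERALLY the shape of the `hUBc` binder of P2's `VariationalCovariantAssembly.pair_bracket`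
p211487 at `Qk := QT n M T`, `Sc := n^{−d}·(n²·dirR)`, `qZ := nsq`) ∕ `exists_ub_scalarPair` (the letters of the capstone
`VariationalCovariantScalarPair.scalar_pair_bracket` p211992: `Qc`, `n²/n^d·Σ_μ dirU`) ∕ `exists_ub_lattice` (lattice units, the REG⁺
supplier's `hUB`) — Λ_d = 20d·36^d at w = 0 (crude, explicit), uniform in `n`, the torus and the background class.  WHY LOCAL: the trial function's
values on the block faces are `O(|φ|/n)`, so the bonds crossing a face (where `conj T(x+e_μ)·T(x)` compares transports to two DIFFERENT
base points and is O(1)) cost `O(n^{d−2})·|φ|²` per block like the gradient term, with `|R|, |T| ≤ 1` only (`norm_bond_le`, face case).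
NOT CLAIMED (colour version = the same computation with `Tᴴ` for `conj T`, not filed): the identification of `T`, `R` with Bałaban's `U(Γ^{(j)}_{y,x})`, `U_k(V)` (P2 §4(b) ∕ P1 c5: model level); the bound
`w ≲ d·n·a` for contour transports (a separate geometric leaf, cf. the swarm's `NestedContourTransport*` for the (1.7)∕(1.18) contours);
multi-region ∕ Dirichlet versions ([B9]'s setting).  NE2 NOT proved; spine 0/9 unchanged.
-/

noncomputable section

namespace Summit.QuantumFields.BalabanUV.T4Continuum.VariationalCovariantUpperBound

open Finset
open scoped ComplexConjugate Matrix
open Literature.MathematicalPhysics.QuantumFieldTheory.Balaban1983to89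
open Literature.MathematicalPhysics.QuantumFieldTheory.Balaban1983to89.B5Prop11Plancherel (Tor fine unitVec)
open Literature.MathematicalPhysics.QuantumFieldTheory.Balaban1983to89.B5Prop11Lower (nsq nsq_nonneg)
open Literature.MathematicalPhysics.QuantumFieldTheory.Balaban1983to89.B5Block118 (bpt QsOp QsOp_mulVec)
open Literature.MathematicalPhysics.QuantumFieldTheory.Balaban1983to89.B5AverageCurlStokes (sum_blocks_real)
open Literature.MathematicalPhysics.QuantumFieldTheory.Balaban1983to89.B5Blocks16 (blockOf blockOf_bpt)
open Summit.QuantumFields.BalabanUV.T4Continuum.ScalarBlockTrialFunction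
  (bump beta1 beta1_ge bumpW bumpW_mem bumpW_update prod_erase_mem bump_face trial trial_bpt QsOp_trial norm_step_trial_le
   bpt_add_unitVec_of_lt bpt_add_unitVec_of_eq)
open Summit.QuantumFields.BalabanUV.T4Continuum.VariationalCovariantPoincare (QT dirR)
open Summit.QuantumFields.BalabanUV.T4Continuum.VariationalCovariantFederbush (Qc dirU)
open Summit.QuantumFields.BalabanUV.T4Continuum.VariationalTransfer (blockSpin blockSpin_le)

variable {d : ℕ} (n : ℕ) [NeZero n] (M : Fin d → ℕ) [hM : ∀ μ, NeZero (M μ)]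

/-! ## §1 Unit transports: `conj T · T = 1` -/
omit [NeZero n] hM in
/-- `|t| = 1 ⇒ t·conj t = 1` and `conj t·t = 1`. [folklore] -/
theorem mul_conj_of_norm_one {t : ℂ} (ht : ‖t‖ = 1) : t * conj t = 1 ∧ conj t * t = 1 := by
  rw [Complex.mul_conj', Complex.conj_mul', ht]; norm_num

/-! ## §2 The competitor `λ_φ = conj T · (β₁^d)⁻¹ · ψ_φ` meets the transported constraint exactly -/

/-- the normalising constant `c = (β₁^d)⁻¹` is positive and at most `6^d`. [folklore] -/
theorem inv_beta_pow_mem : 0 < ((beta1 n) ^ d)⁻¹ ∧ ((beta1 n) ^ d)⁻¹ ≤ (6 : ℝ) ^ d := by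
  obtain ⟨h16, h0⟩ := beta1_ge n
  refine ⟨inv_pos.mpr (pow_pos h0 d), ?_⟩
  rw [inv_le_comm₀ (pow_pos h0 d) (by positivity), ← inv_pow]
  exact pow_le_pow_left₀ (by norm_num) (by rw [inv_eq_one_div]; exact h16) d

/-- **CONSTRAINT, EXACTLY**: `QT n M T λ_φ = φ` for unit site transports — the phases cancel (`T·conj T = 1`) and the trial function
has block means `β₁^d·φ` (`ScalarBlockTrialFunction.QsOp_trial`). [folklore] -/
theorem QT_comp {T : Tor (fine n M) → ℂ} (hT : ∀ x, ‖T x‖ = 1) (φ : Tor M → ℂ) :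
    QT n M T (fun x => conj (T x) * (((((beta1 n) ^ d)⁻¹ : ℝ) : ℂ) * trial n M φ x)) = φ := by
  have hβ : (beta1 n) ^ d ≠ 0 := (pow_pos (beta1_ge n).2 d).ne'
  have hn : ((n : ℂ) ^ d) ≠ 0 := pow_ne_zero _ (by exact_mod_cast NeZero.ne n)
  funext z
  have hQ : (QsOp n M *ᵥ trial n M φ) z = (((beta1 n) ^ d : ℝ) : ℂ) * φ z := by
    rw [QsOp_trial]; rfl
  rw [QsOp_mulVec] at hQ
  have hsum : ∑ j : Fin d → Fin n, trial n M φ (bpt n M z j) = (n : ℂ) ^ d * ((((beta1 n) ^ d : ℝ) : ℂ) * φ z) := by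
    rw [← hQ]; field_simp
  unfold QT
  have hj : ∀ j : Fin d → Fin n, T (bpt n M z j) * (conj (T (bpt n M z j)) * (((((beta1 n) ^ d)⁻¹ : ℝ) : ℂ) * trial n M φ (bpt n M z j)))
      = ((((beta1 n) ^ d)⁻¹ : ℝ) : ℂ) * trial n M φ (bpt n M z j) := by
    intro j
    rw [← mul_assoc, (mul_conj_of_norm_one (hT _)).1, one_mul]
  simp_rw [hj]
  rw [← mul_sum, hsum]
  have hβc : ((beta1 n : ℝ) : ℂ) ≠ 0 := by exact_mod_cast (beta1_ge n).2.ne'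
  push_cast
  field_simp

/-! ## §3 The bond-wise bound: in-block bonds by the defect `w`, face bonds by the face values `|φ|/n` -/

omit [NeZero n] hM in
/-- the covariant difference of `conj T · g` splits into the plain difference of `g` and the transport defect acting on `g(x+e)`:
`R·conj T(x′)·g(x′) − conj T(x)·g(x) = conj T(x)·(g(x′) − g(x)) + (R·conj T(x′)·T(x) − 1)·conj T(x)·g(x′)` when `T(x)·conj T(x) = 1`. [folklore] -/
theorem cov_diff_split {T : Tor (fine n M) → ℂ} (hT : ∀ x, ‖T x‖ = 1) (R : ℂ) (g : Tor (fine n M) → ℂ) (x x' : Tor (fine n M)) :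
    R * (conj (T x') * g x') - conj (T x) * g x
      = conj (T x) * (g x' - g x) + (R * conj (T x') * T x - 1) * (conj (T x) * g x') := by
  have h1 := (mul_conj_of_norm_one (hT x)).1
  linear_combination (-(R * conj (T x') * g x')) * h1

omit [NeZero n] hM in
/-- norm form of the split: `|R·λ(x′) − λ(x)| ≤ |g(x′) − g(x)| + |R·conj T(x′)·T(x) − 1|·|g(x′)|`. [folklore] -/
theorem norm_cov_diff_le {T : Tor (fine n M) → ℂ} (hT : ∀ x, ‖T x‖ = 1) (R : ℂ) (g : Tor (fine n M) → ℂ) (x x' : Tor (fine n M)) :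
    ‖R * (conj (T x') * g x') - conj (T x) * g x‖ ≤ ‖g x' - g x‖ + ‖R * conj (T x') * T x - 1‖ * ‖g x'‖ := by
  rw [cov_diff_split n M hT]
  refine (norm_add_le _ _).trans (le_of_eq ?_)
  rw [norm_mul, norm_mul, norm_mul, Complex.norm_conj, hT, one_mul, one_mul]

omit [NeZero n] hM in
/-- the defect is at most `2` for contractive phases and unit transports. [folklore] -/
theorem norm_defect_le_two {T : Tor (fine n M) → ℂ} (hT : ∀ x, ‖T x‖ = 1) {R : ℂ} (hR : ‖R‖ ≤ 1) (x x' : Tor (fine n M)) :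
    ‖R * conj (T x') * T x - 1‖ ≤ 2 := by
  refine (norm_sub_le _ _).trans ?_
  rw [norm_mul, norm_mul, Complex.norm_conj, hT, hT, mul_one, mul_one, norm_one]
  linarith

/-- the trial function's values: `|ψ_φ(n·y+j)| ≤ |φ(y)|` everywhere and `|ψ_φ(n·y+j[μ↦0])| ≤ |φ(y)|/n` on the entry face. [folklore] -/
theorem norm_trial_le (φ : Tor M → ℂ) (y : Tor M) (j : Fin d → Fin n) (μ : Fin d) :
    ‖trial n M φ (bpt n M y j)‖ ≤ ‖φ y‖ ∧ ‖trial n M φ (bpt n M y (Function.update j μ 0))‖ ≤ ‖φ y‖ / n := by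
  have hn0 : (0 : ℝ) < n := by exact_mod_cast Nat.pos_of_ne_zero (NeZero.ne n)
  constructor
  · rw [trial_bpt, norm_mul, Complex.norm_real, Real.norm_of_nonneg (bumpW_mem n j).1]
    exact mul_le_of_le_one_right (norm_nonneg _) (bumpW_mem n j).2
  · obtain ⟨hR0, hR1⟩ := prod_erase_mem n j μ
    have hW : bumpW n (Function.update j μ 0) = bump n ((0 : Fin n) : ℕ) * ∏ ν ∈ Finset.univ.erase μ, bump n (j ν) :=
      (bumpW_update n j μ 0).1
    have hface : bump n ((0 : Fin n) : ℕ) = 1 / n := by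
      have hpred : (n - 1) + 1 = n := Nat.sub_add_cancel (Nat.pos_of_ne_zero (NeZero.ne n))
      rw [Fin.val_zero]; exact (bump_face n (n - 1) hpred).2
    rw [trial_bpt, norm_mul, Complex.norm_real, hW, hface, Real.norm_of_nonneg (by positivity)]
    have h1 : 1 / (n : ℝ) * ∏ ν ∈ Finset.univ.erase μ, bump n (j ν) ≤ 1 / (n : ℝ) :=
      mul_le_of_le_one_right (by positivity) hR1
    calc ‖φ y‖ * (1 / (n : ℝ) * ∏ ν ∈ Finset.univ.erase μ, bump n (j ν)) ≤ ‖φ y‖ * (1 / (n : ℝ)) :=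
          mul_le_mul_of_nonneg_left h1 (norm_nonneg _)
      _ = ‖φ y‖ / n := by ring

/-- **BOND-WISE BOUND** at `x = n·y + j`, direction `μ`, for the competitor `λ_φ = conj T·c·ψ_φ` (`c = (β₁^d)⁻¹`):
`|R(x,μ)λ_φ(x+e_μ) − λ_φ(x)| ≤ (c/n)·((1 + n·w)·|φ(y)| + 3·|φ(y+e_μ)|)` — in-block bonds pay the defect `w` on `|ψ_φ| ≤ |φ(y)|`, face bonds
pay the trivial defect `2` on the face value `|φ(y+e_μ)|/n`; the plain difference is leaf-09's `norm_step_trial_le`. [folklore] -/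
theorem norm_bond_le {T : Tor (fine n M) → ℂ} (hT : ∀ x, ‖T x‖ = 1) {R : Tor (fine n M) → Fin d → ℂ} (hR : ∀ x μ, ‖R x μ‖ ≤ 1)
    {w : ℝ} (hw0 : 0 ≤ w)
    (hw : ∀ (y : Tor M) (j : Fin d → Fin n) (μ : Fin d), (j μ : ℕ) + 1 < n →
      ‖R (bpt n M y j) μ * conj (T (bpt n M y j + unitVec (fine n M) μ)) * T (bpt n M y j) - 1‖ ≤ w)
    (φ : Tor M → ℂ) (y : Tor M) (j : Fin d → Fin n) (μ : Fin d) :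
    ‖R (bpt n M y j) μ * (conj (T (bpt n M y j + unitVec (fine n M) μ))
          * (((((beta1 n) ^ d)⁻¹ : ℝ) : ℂ) * trial n M φ (bpt n M y j + unitVec (fine n M) μ)))
        - conj (T (bpt n M y j)) * (((((beta1 n) ^ d)⁻¹ : ℝ) : ℂ) * trial n M φ (bpt n M y j))‖
      ≤ ((beta1 n) ^ d)⁻¹ / n * ((1 + n * w) * ‖φ y‖ + 3 * ‖φ (y + unitVec M μ)‖) := by
  set c : ℝ := ((beta1 n) ^ d)⁻¹ with hc
  obtain ⟨hc0, -⟩ := inv_beta_pow_mem n (d := d)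
  have hn0 : (0 : ℝ) < n := by exact_mod_cast Nat.pos_of_ne_zero (NeZero.ne n)
  have hn' : (n : ℝ) ≠ 0 := hn0.ne'
  have hsplit := norm_cov_diff_le n M hT (R (bpt n M y j) μ) (fun z => ((c : ℝ) : ℂ) * trial n M φ z)
    (bpt n M y j) (bpt n M y j + unitVec (fine n M) μ)
  beta_reduce at hsplit
  -- the plain difference: leaf-09's one-step bound, divided by `n`
  have hstep : ‖((c : ℝ) : ℂ) * trial n M φ (bpt n M y j + unitVec (fine n M) μ) - ((c : ℝ) : ℂ) * trial n M φ (bpt n M y j)‖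
      ≤ c / n * (‖φ y‖ + ‖φ (y + unitVec M μ)‖) := by
    have h := norm_step_trial_le n M φ y j μ
    rw [norm_mul, Complex.norm_natCast] at h
    have h' : ‖trial n M φ (bpt n M y j + unitVec (fine n M) μ) - trial n M φ (bpt n M y j)‖
        ≤ (‖φ y‖ + ‖φ (y + unitVec M μ)‖) / n := by
      rw [le_div_iff₀ hn0, mul_comm]; exact h
    rw [← mul_sub, norm_mul, Complex.norm_real, Real.norm_of_nonneg hc0.le]
    calc c * ‖trial n M φ (bpt n M y j + unitVec (fine n M) μ) - trial n M φ (bpt n M y j)‖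
        ≤ c * ((‖φ y‖ + ‖φ (y + unitVec M μ)‖) / n) := mul_le_mul_of_nonneg_left h' hc0.le
      _ = c / n * (‖φ y‖ + ‖φ (y + unitVec M μ)‖) := by ring
  have hφ0 : 0 ≤ ‖φ y‖ := norm_nonneg _
  have hφ1 : 0 ≤ ‖φ (y + unitVec M μ)‖ := norm_nonneg _
  by_cases hlt : (j μ : ℕ) + 1 < n
  · -- IN-BLOCK bond: defect ≤ w, value ≤ c|φ y|
    have hv := hw y j μ hlt
    have hgx' : ‖((c : ℝ) : ℂ) * trial n M φ (bpt n M y j + unitVec (fine n M) μ)‖ ≤ c * ‖φ y‖ := by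
      rw [bpt_add_unitVec_of_lt n M y j μ hlt, norm_mul, Complex.norm_real, Real.norm_of_nonneg hc0.le]
      exact mul_le_mul_of_nonneg_left (norm_trial_le n M φ y _ μ).1 hc0.le
    calc _ ≤ _ := hsplit
      _ ≤ c / n * (‖φ y‖ + ‖φ (y + unitVec M μ)‖) + w * (c * ‖φ y‖) :=
          add_le_add hstep (mul_le_mul hv hgx' (norm_nonneg _) hw0)
      _ = c / n * ((1 + n * w) * ‖φ y‖ + ‖φ (y + unitVec M μ)‖) := by field_simp; ring
      _ ≤ c / n * ((1 + n * w) * ‖φ y‖ + 3 * ‖φ (y + unitVec M μ)‖) := by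
          refine mul_le_mul_of_nonneg_left ?_ (by positivity); linarith
  · -- FACE bond: defect ≤ 2, value ≤ c|φ(y+e_μ)|/n
    have heq : (j μ : ℕ) + 1 = n := by have := (j μ).is_lt; omega
    have hv : ‖R (bpt n M y j) μ * conj (T (bpt n M y j + unitVec (fine n M) μ)) * T (bpt n M y j) - 1‖ ≤ 2 :=
      norm_defect_le_two n M hT (hR _ μ) _ _
    have hgx' : ‖((c : ℝ) : ℂ) * trial n M φ (bpt n M y j + unitVec (fine n M) μ)‖ ≤ c * (‖φ (y + unitVec M μ)‖ / n) := by
      rw [bpt_add_unitVec_of_eq n M y j μ heq, norm_mul, Complex.norm_real, Real.norm_of_nonneg hc0.le]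
      exact mul_le_mul_of_nonneg_left (norm_trial_le n M φ (y + unitVec M μ) j μ).2 hc0.le
    have hnw : 0 ≤ n * w := by positivity
    calc _ ≤ _ := hsplit
      _ ≤ c / n * (‖φ y‖ + ‖φ (y + unitVec M μ)‖) + 2 * (c * (‖φ (y + unitVec M μ)‖ / n)) :=
          add_le_add hstep (mul_le_mul hv hgx' (norm_nonneg _) (by norm_num))
      _ = c / n * (‖φ y‖ + 3 * ‖φ (y + unitVec M μ)‖) := by field_simp; ring
      _ ≤ c / n * ((1 + n * w) * ‖φ y‖ + 3 * ‖φ (y + unitVec M μ)‖) := by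
          refine mul_le_mul_of_nonneg_left ?_ (by positivity); nlinarith

/-! ## §4 Summing over blocks, base points and directions -/
/-- **LEAF UB⁺ (lattice units)**: `n²·dirR R λ_φ ≤ 2d·(β₁^d)⁻²·((1 + n w)² + 9)·(n^d·Σ_y|φ y|²)`. [folklore] -/
theorem sq_mul_dirR_comp_le {T : Tor (fine n M) → ℂ} (hT : ∀ x, ‖T x‖ = 1) {R : Tor (fine n M) → Fin d → ℂ}
    (hR : ∀ x μ, ‖R x μ‖ ≤ 1) {w : ℝ} (hw0 : 0 ≤ w)
    (hw : ∀ (y : Tor M) (j : Fin d → Fin n) (μ : Fin d), (j μ : ℕ) + 1 < n →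
      ‖R (bpt n M y j) μ * conj (T (bpt n M y j + unitVec (fine n M) μ)) * T (bpt n M y j) - 1‖ ≤ w)
    (φ : Tor M → ℂ) :
    (n : ℝ) ^ 2 * dirR n M R (fun x => conj (T x) * (((((beta1 n) ^ d)⁻¹ : ℝ) : ℂ) * trial n M φ x))
      ≤ 2 * d * (((beta1 n) ^ d)⁻¹) ^ 2 * ((1 + n * w) ^ 2 + 9) * ((n : ℝ) ^ d * nsq φ) := by
  set c : ℝ := ((beta1 n) ^ d)⁻¹ with hc
  have hn0 : (0 : ℝ) < n := by exact_mod_cast Nat.pos_of_ne_zero (NeZero.ne n)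
  have hn' : (n : ℝ) ≠ 0 := hn0.ne'
  have hcard : (Fintype.card (Fin d → Fin n) : ℝ) = (n : ℝ) ^ d := by
    rw [Fintype.card_fun, Fintype.card_fin, Fintype.card_fin]; push_cast; ring
  have hshift : ∀ μ : Fin d, ∑ y : Tor M, ‖φ (y + unitVec M μ)‖ ^ 2 = nsq φ := fun μ =>
    Fintype.sum_equiv (Equiv.addRight (unitVec M μ)) _ _ fun y => rfl
  -- per direction
  have hμ : ∀ μ : Fin d, (n : ℝ) ^ 2 * ∑ x, ‖R x μ * (conj (T (x + unitVec (fine n M) μ))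
        * (((c : ℝ) : ℂ) * trial n M φ (x + unitVec (fine n M) μ))) - conj (T x) * (((c : ℝ) : ℂ) * trial n M φ x)‖ ^ 2
      ≤ 2 * c ^ 2 * ((1 + n * w) ^ 2 + 9) * ((n : ℝ) ^ d * nsq φ) := by
    intro μ
    rw [sum_blocks_real n M (fun x => ‖R x μ * (conj (T (x + unitVec (fine n M) μ))
        * (((c : ℝ) : ℂ) * trial n M φ (x + unitVec (fine n M) μ))) - conj (T x) * (((c : ℝ) : ℂ) * trial n M φ x)‖ ^ 2)]
    have hpt : ∀ (y : Tor M) (j : Fin d → Fin n),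
        (n : ℝ) ^ 2 * ‖R (bpt n M y j) μ * (conj (T (bpt n M y j + unitVec (fine n M) μ))
            * (((c : ℝ) : ℂ) * trial n M φ (bpt n M y j + unitVec (fine n M) μ)))
          - conj (T (bpt n M y j)) * (((c : ℝ) : ℂ) * trial n M φ (bpt n M y j))‖ ^ 2
        ≤ 2 * c ^ 2 * ((1 + n * w) ^ 2 * ‖φ y‖ ^ 2 + 9 * ‖φ (y + unitVec M μ)‖ ^ 2) := by
      intro y j
      have h := norm_bond_le n M hT hR hw0 hw φ y j μ
      have h2 := pow_le_pow_left₀ (norm_nonneg _) h 2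
      have e : (n : ℝ) ^ 2 * (c / n * ((1 + n * w) * ‖φ y‖ + 3 * ‖φ (y + unitVec M μ)‖)) ^ 2
          = c ^ 2 * ((1 + n * w) * ‖φ y‖ + 3 * ‖φ (y + unitVec M μ)‖) ^ 2 := by
        field_simp
      have h3 : ((1 + n * w) * ‖φ y‖ + 3 * ‖φ (y + unitVec M μ)‖) ^ 2
          ≤ 2 * ((1 + n * w) ^ 2 * ‖φ y‖ ^ 2 + 9 * ‖φ (y + unitVec M μ)‖ ^ 2) := by
        nlinarith [sq_nonneg ((1 + n * w) * ‖φ y‖ - 3 * ‖φ (y + unitVec M μ)‖)]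
      calc _ ≤ (n : ℝ) ^ 2 * (c / n * ((1 + n * w) * ‖φ y‖ + 3 * ‖φ (y + unitVec M μ)‖)) ^ 2 :=
            mul_le_mul_of_nonneg_left h2 (by positivity)
        _ = c ^ 2 * ((1 + n * w) * ‖φ y‖ + 3 * ‖φ (y + unitVec M μ)‖) ^ 2 := e
        _ ≤ _ := by nlinarith [h3, sq_nonneg c]
    rw [mul_sum]
    calc ∑ y : Tor M, (n : ℝ) ^ 2 * ∑ j : Fin d → Fin n, ‖R (bpt n M y j) μ * (conj (T (bpt n M y j + unitVec (fine n M) μ))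
            * (((c : ℝ) : ℂ) * trial n M φ (bpt n M y j + unitVec (fine n M) μ)))
          - conj (T (bpt n M y j)) * (((c : ℝ) : ℂ) * trial n M φ (bpt n M y j))‖ ^ 2
        ≤ ∑ y : Tor M, ∑ _j : Fin d → Fin n, 2 * c ^ 2 * ((1 + n * w) ^ 2 * ‖φ y‖ ^ 2 + 9 * ‖φ (y + unitVec M μ)‖ ^ 2) := by
          refine sum_le_sum fun y _ => ?_
          rw [mul_sum]
          exact sum_le_sum fun j _ => hpt y j
      _ = ∑ y : Tor M, ((n : ℝ) ^ d * (2 * c ^ 2 * (1 + n * w) ^ 2) * ‖φ y‖ ^ 2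
            + (n : ℝ) ^ d * (2 * c ^ 2 * 9) * ‖φ (y + unitVec M μ)‖ ^ 2) := by
          simp only [sum_const, card_univ, nsmul_eq_mul, hcard]
          exact sum_congr rfl fun y _ => by ring
      _ = 2 * c ^ 2 * ((1 + n * w) ^ 2 + 9) * ((n : ℝ) ^ d * nsq φ) := by
          rw [sum_add_distrib, ← mul_sum, ← mul_sum, hshift μ]; unfold nsq; ring
  unfold dirR
  rw [mul_sum]
  calc _ ≤ ∑ _μ : Fin d, 2 * c ^ 2 * ((1 + n * w) ^ 2 + 9) * ((n : ℝ) ^ d * nsq φ) := sum_le_sum fun μ _ => hμ μ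
    _ = 2 * d * c ^ 2 * ((1 + n * w) ^ 2 + 9) * ((n : ℝ) ^ d * nsq φ) := by
        rw [sum_const, card_univ, Fintype.card_fin, nsmul_eq_mul]; ring

/-- **LEAF UB⁺ (physical units, explicit constant)**: `n^{2−d}·dirR R λ_φ ≤ 2d·36^d·((1 + n w)² + 9)·Σ_y|φ y|²` — the covariant Dirichlet
ACTION of the competitor in the normalisation `Sc(λ) = n^{2−d}Σ|D_Rλ|²` ([B9] (3.23) prefactor `(L^jη)^{d−2}` with `L^jη = n⁻¹`; SHAPE only)
against the unit-lattice `ℓ²` norm of `φ`. [folklore] -/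
theorem physDir_comp_le {T : Tor (fine n M) → ℂ} (hT : ∀ x, ‖T x‖ = 1) {R : Tor (fine n M) → Fin d → ℂ}
    (hR : ∀ x μ, ‖R x μ‖ ≤ 1) {w : ℝ} (hw0 : 0 ≤ w)
    (hw : ∀ (y : Tor M) (j : Fin d → Fin n) (μ : Fin d), (j μ : ℕ) + 1 < n →
      ‖R (bpt n M y j) μ * conj (T (bpt n M y j + unitVec (fine n M) μ)) * T (bpt n M y j) - 1‖ ≤ w)
    (φ : Tor M → ℂ) :
    ((n : ℝ) ^ d)⁻¹ * ((n : ℝ) ^ 2 * dirR n M R (fun x => conj (T x) * (((((beta1 n) ^ d)⁻¹ : ℝ) : ℂ) * trial n M φ x)))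
      ≤ 2 * d * (36 : ℝ) ^ d * ((1 + n * w) ^ 2 + 9) * nsq φ := by
  have hn0 : (0 : ℝ) < (n : ℝ) ^ d := by have := NeZero.ne n; positivity
  have h := sq_mul_dirR_comp_le n M hT hR hw0 hw φ
  obtain ⟨hc0, hc6⟩ := inv_beta_pow_mem n (d := d)
  have hc2 : (((beta1 n) ^ d)⁻¹) ^ 2 ≤ (36 : ℝ) ^ d := by
    calc (((beta1 n) ^ d)⁻¹) ^ 2 ≤ ((6 : ℝ) ^ d) ^ 2 := pow_le_pow_left₀ hc0.le hc6 2
      _ = (36 : ℝ) ^ d := by rw [← pow_mul, mul_comm, pow_mul]; norm_num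
  have hφ := nsq_nonneg φ
  rw [inv_mul_le_iff₀ hn0]
  calc _ ≤ 2 * d * (((beta1 n) ^ d)⁻¹) ^ 2 * ((1 + n * w) ^ 2 + 9) * ((n : ℝ) ^ d * nsq φ) := h
    _ ≤ 2 * d * (36 : ℝ) ^ d * ((1 + n * w) ^ 2 + 9) * ((n : ℝ) ^ d * nsq φ) := by gcongr
    _ = _ := by ring

/-! ## §5 The UB⁺ reading for the block-spin value (P2's `VariationalTransfer.blockSpin`) -/
/-- **LEAF UB⁺ (block-spin reading)**: the covariant scalar effective action `Δ′(φ) = inf {Sc(λ) : Q_T λ = φ}`,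
`Sc(λ) = n^{2−d}Σ_{μ,x}|R(x,μ)λ(x+e_μ) − λ(x)|²`, obeys `Δ′(φ) ≤ 2d·36^d·((1 + n·w)² + 9)·Σ_y|φ(y)|²` — k-UNIFORM (the level enters only
through `n·w`), every torus, under unit site transports, contractive phases and the IN-BLOCK transport defect `w`; no global frame. [folklore] -/
theorem blockSpin_covariant_le {T : Tor (fine n M) → ℂ} (hT : ∀ x, ‖T x‖ = 1) {R : Tor (fine n M) → Fin d → ℂ}
    (hR : ∀ x μ, ‖R x μ‖ ≤ 1) {w : ℝ} (hw0 : 0 ≤ w)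
    (hw : ∀ (y : Tor M) (j : Fin d → Fin n) (μ : Fin d), (j μ : ℕ) + 1 < n →
      ‖R (bpt n M y j) μ * conj (T (bpt n M y j + unitVec (fine n M) μ)) * T (bpt n M y j) - 1‖ ≤ w)
    (φ : Tor M → ℂ) :
    blockSpin (QT n M T) (fun f => ((n : ℝ) ^ d)⁻¹ * ((n : ℝ) ^ 2 * dirR n M R f)) φ
      ≤ 2 * d * (36 : ℝ) ^ d * ((1 + n * w) ^ 2 + 9) * nsq φ := by
  have hS : ∀ f : Tor (fine n M) → ℂ, 0 ≤ ((n : ℝ) ^ d)⁻¹ * ((n : ℝ) ^ 2 * dirR n M R f) := fun f => by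
    have : 0 ≤ dirR n M R f := sum_nonneg fun _ _ => sum_nonneg fun _ _ => by positivity
    positivity
  exact (blockSpin_le hS (QT_comp n M hT φ)).trans (physDir_comp_le n M hT hR hw0 hw φ)

/-! ## §6 The same with the in-block hypothesis phrased by blocks (`blockOf (x + e_μ) = blockOf x`) -/

/-- base-point form ⇐ block form: a bond `(n·y + j, n·y + j + e_μ)` with `j_μ + 1 < n` has both ends in block `y`. [folklore] -/
theorem inBlock_of_blockOf {T : Tor (fine n M) → ℂ} {R : Tor (fine n M) → Fin d → ℂ} {w : ℝ}
    (hw' : ∀ (x : Tor (fine n M)) (μ : Fin d), blockOf n M (x + unitVec (fine n M) μ) = blockOf n M x →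
      ‖R x μ * conj (T (x + unitVec (fine n M) μ)) * T x - 1‖ ≤ w)
    (y : Tor M) (j : Fin d → Fin n) (μ : Fin d) (h : (j μ : ℕ) + 1 < n) :
    ‖R (bpt n M y j) μ * conj (T (bpt n M y j + unitVec (fine n M) μ)) * T (bpt n M y j) - 1‖ ≤ w := by
  apply hw'
  rw [bpt_add_unitVec_of_lt n M y j μ h, blockOf_bpt, blockOf_bpt]

/-- **LEAF UB⁺, block form of the hypothesis**: if every bond with both ends in ONE block has transport defect
`|R(x,μ)·conj T(x+e_μ)·T(x) − 1| ≤ w`, then `Δ′(φ) ≤ 2d·36^d·((1 + n·w)² + 9)·Σ|φ|²`. [folklore] -/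
theorem blockSpin_covariant_le_of_blockOf {T : Tor (fine n M) → ℂ} (hT : ∀ x, ‖T x‖ = 1) {R : Tor (fine n M) → Fin d → ℂ}
    (hR : ∀ x μ, ‖R x μ‖ ≤ 1) {w : ℝ} (hw0 : 0 ≤ w)
    (hw' : ∀ (x : Tor (fine n M)) (μ : Fin d), blockOf n M (x + unitVec (fine n M) μ) = blockOf n M x →
      ‖R x μ * conj (T (x + unitVec (fine n M) μ)) * T x - 1‖ ≤ w)
    (φ : Tor M → ℂ) :
    blockSpin (QT n M T) (fun f => ((n : ℝ) ^ d)⁻¹ * ((n : ℝ) ^ 2 * dirR n M R f)) φ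
      ≤ 2 * d * (36 : ℝ) ^ d * ((1 + n * w) ^ 2 + 9) * nsq φ :=
  blockSpin_covariant_le n M hT hR hw0 (inBlock_of_blockOf n M hw') φ

/-! ## §7 The `∃`-forms consumed by P2's assembly (`VariationalCovariantAssembly.pair_bracket`, binder `hUBc`) and by REG⁺ (`hUB`) -/

/-- **LEAF UB⁺, `∃`-form, physical units** — literally the shape of the `hUBc` binder of
`VariationalCovariantAssembly.pair_bracket` at `Qk := QT n M T`, `Sc f := n^{−d}·(n²·dirR n M R f)`, `qZ := nsq`,
`Λ := 2d·36^d·((1 + n·w)² + 9)`. [folklore] -/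
theorem exists_ub_phys {T : Tor (fine n M) → ℂ} (hT : ∀ x, ‖T x‖ = 1) {R : Tor (fine n M) → Fin d → ℂ}
    (hR : ∀ x μ, ‖R x μ‖ ≤ 1) {w : ℝ} (hw0 : 0 ≤ w)
    (hw : ∀ (y : Tor M) (j : Fin d → Fin n) (μ : Fin d), (j μ : ℕ) + 1 < n →
      ‖R (bpt n M y j) μ * conj (T (bpt n M y j + unitVec (fine n M) μ)) * T (bpt n M y j) - 1‖ ≤ w) :
    ∀ φ : Tor M → ℂ, ∃ f : Tor (fine n M) → ℂ, QT n M T f = φ ∧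
      ((n : ℝ) ^ d)⁻¹ * ((n : ℝ) ^ 2 * dirR n M R f) ≤ 2 * d * (36 : ℝ) ^ d * ((1 + n * w) ^ 2 + 9) * nsq φ :=
  fun φ => ⟨_, QT_comp n M hT φ, physDir_comp_le n M hT hR hw0 hw φ⟩

/-- **LEAF UB⁺, `∃`-form, lattice units** (the `hUB` binder of the REG⁺ supplier, `Λ_lat = 2d·36^d·((1 + n w)² + 9)·n^d/n²`):
`∃ f, QT n M T f = φ ∧ dirR n M R f ≤ Λ_lat·Σ|φ|²`. [folklore] -/
theorem exists_ub_lattice {T : Tor (fine n M) → ℂ} (hT : ∀ x, ‖T x‖ = 1) {R : Tor (fine n M) → Fin d → ℂ}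
    (hR : ∀ x μ, ‖R x μ‖ ≤ 1) {w : ℝ} (hw0 : 0 ≤ w)
    (hw : ∀ (y : Tor M) (j : Fin d → Fin n) (μ : Fin d), (j μ : ℕ) + 1 < n →
      ‖R (bpt n M y j) μ * conj (T (bpt n M y j + unitVec (fine n M) μ)) * T (bpt n M y j) - 1‖ ≤ w) :
    ∀ φ : Tor M → ℂ, ∃ f : Tor (fine n M) → ℂ, QT n M T f = φ ∧
      dirR n M R f ≤ (2 * d * (36 : ℝ) ^ d * ((1 + n * w) ^ 2 + 9) * (n : ℝ) ^ d / (n : ℝ) ^ 2) * nsq φ := by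
  intro φ
  refine ⟨_, QT_comp n M hT φ, ?_⟩
  have hn2 : (0 : ℝ) < (n : ℝ) ^ 2 := by have := NeZero.ne n; positivity
  have hnd : (0 : ℝ) < (n : ℝ) ^ d := by have := NeZero.ne n; positivity
  have h := physDir_comp_le n M hT hR hw0 hw φ
  rw [inv_mul_le_iff₀ hnd] at h
  -- `n²·D ≤ n^d·(Λ·q)` ⇒ `D ≤ (Λ·n^d/n²)·q`
  rw [show (2 * d * (36 : ℝ) ^ d * ((1 + n * w) ^ 2 + 9) * (n : ℝ) ^ d / (n : ℝ) ^ 2) * nsq φ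
      = ((n : ℝ) ^ d * (2 * d * (36 : ℝ) ^ d * ((1 + n * w) ^ 2 + 9) * nsq φ)) / (n : ℝ) ^ 2 by ring]
  rw [le_div_iff₀ hn2, mul_comm]
  exact h

/-- **LEAF UB⁺, `∃`-form in the CAPSTONE's letters** (`VariationalCovariantScalarPair.scalar_pair_bracket`, binder
`hUBc : ∀ μ, ∃ f, Qk n M T f = μ ∧ Sc n M Rc f ≤ Λ·nsq μ` with `Qk n M T f := fun z => Qc n M T f z` and
`Sc n M Rc f := n²/n^d·Σ_μ dirU (fine n M) Rc f μ` — both unfold to the two sides below by `rfl`):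
`∃ f, (fun z => Qc n M T f z) = φ ∧ n²/n^d·Σ_μ dirU (fine n M) R f μ ≤ 2d·36^d·((1 + n w)² + 9)·nsq φ`.  (The fine-level binder `hUBf`
for the COMPOSITE constraint is this theorem at level `n·L` with the composite transports, transported along the tree's two-level
reindexing `B5Composition116.sites`/`bpt_bpt` — dictionary COMP⁺ of the P2 skeleton, not restated here.) [folklore] -/
theorem exists_ub_scalarPair {T : Tor (fine n M) → ℂ} (hT : ∀ x, ‖T x‖ = 1) {R : Tor (fine n M) → Fin d → ℂ}
    (hR : ∀ x μ, ‖R x μ‖ ≤ 1) {w : ℝ} (hw0 : 0 ≤ w)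
    (hw : ∀ (y : Tor M) (j : Fin d → Fin n) (μ : Fin d), (j μ : ℕ) + 1 < n →
      ‖R (bpt n M y j) μ * conj (T (bpt n M y j + unitVec (fine n M) μ)) * T (bpt n M y j) - 1‖ ≤ w) :
    ∀ φ : Tor M → ℂ, ∃ f : Tor (fine n M) → ℂ, (fun z => Qc n M T f z) = φ ∧
      (n : ℝ) ^ 2 / (n : ℝ) ^ d * ∑ μ, dirU (fine n M) R f μ ≤ 2 * d * (36 : ℝ) ^ d * ((1 + n * w) ^ 2 + 9) * nsq φ := by
  intro φ
  obtain ⟨f, hf, hb⟩ := exists_ub_phys n M hT hR hw0 hw φ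
  refine ⟨f, hf, ?_⟩
  have hD : dirR n M R f = ∑ μ, dirU (fine n M) R f μ := rfl
  have e : (n : ℝ) ^ 2 / (n : ℝ) ^ d * ∑ μ, dirU (fine n M) R f μ = ((n : ℝ) ^ d)⁻¹ * ((n : ℝ) ^ 2 * dirR n M R f) := by
    rw [div_eq_mul_inv, hD]; ring
  rw [e]; exact hb

end Summit.QuantumFields.BalabanUV.T4Continuum.VariationalCovariantUpperBound

end
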